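import Summits.NavierStokesRegularity.FunctionalMining.StretchingLaminateConst
import Summits.NavierStokesRegularity.FunctionalMining.StretchingLaminateBetchov
import Summits.NavierStokesRegularity.FunctionalMining.StretchingLaminateSupermartingale
import Mathlib.LinearAlgebra.Matrix.Trace
import Mathlib.Analysis.Normed.Algebra.MatrixExponential
import Mathlib.Analysis.Matrix.Normed
import Mathlib.Analysis.Matrix.Spectrum
import Mathlib.Analysis.Calculus.FDeriv.Analytic
import Mathlib.Analysis.Calculus.ContDiff.Basic
import Mathlib.Topology.Algebra.Module.FiniteDimension
import Mathlib.Analysis.SpecialFunctions.Log.Basic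
import Mathlib.Analysis.SpecialFunctions.Log.Deriv
import Mathlib.Analysis.SpecialFunctions.Sqrt
import Mathlib.Analysis.Complex.ExponentialBounds
import Mathlib.LinearAlgebra.Matrix.Symmetric
import Mathlib.LinearAlgebra.Matrix.Notation
import Mathlib.Analysis.Convex.Deriv
import Mathlib.Analysis.Calculus.IteratedDeriv.Lemmas
import Mathlib.Analysis.Calculus.Deriv.CompMul
import Mathlib.Analysis.Calculus.Deriv.Shift
import Mathlib.Analysis.Calculus.ContDiff.Deriv
import Mathlib.Analysis.Calculus.SmoothSeries
import Mathlib.Analysis.SpecialFunctions.Exponential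
import Mathlib.Analysis.Calculus.Deriv.Mul
import Mathlib.Analysis.Calculus.Deriv.Inv
import Mathlib.Tactic.Linarith
import Mathlib.Tactic.FinCases
import HarnessLib

/-!
# FunctionalMining — K1-Q1 laminates, L1 port 1/18 — supersolution principle, Parts A–B (tree level; real states, dictionary)

search for candidate a priori estimates; no regularity claim.

Cell `pub-nsfunc` (host summit NavierStokesRegularity, topic `FunctionalMining`); PORT COPY of the bank seat's scratch
`HOME/pub-nsfunc-bank/tools/lam/upper/u4t/L1-SUPERSOLUTION.scratch.lean` (generic r11, sha16 c63cd257e1f26cb9), lines 159–433,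
verbatim EXCEPT docstrings (overlay `u4t/port/docstrings_r11.json` c4f7e1e1d014a584 = split plan `u4t/PORT-SPLIT-PLAN.md` §4 (E2)/(E3):
new one-line docstrings on formerly undocumented helpers + refreshed hypothesis/proved-downstream docstrings on the `Prop`s;
provenance tags `[ours; …]` appended to every other docstring (tags `u4t/port/tags_r11.json` 7935c0e35cdf68ee, census-2 port note P-B1);
bodies byte-identical to the scratch modulo docstrings — machine-verified by `split_r11.py --overlay`; census readings carry over).

CONTENT (Parts A–B of the supersolution lemma, K1Q1-LAMINATES §16.1). Part A, tree level over the
treeʼs rational states `Grad`: for node functionals `f M` indexed by a vorticity ceiling `M > 0`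
satisfying (S2) `f M 0 ≤ 0`, (S1) the leaf majorisation `ωᵀSω − (θ/2)·M·|ω|² ≤ f M G` and (S3) the
super-split inequality on the ball `|ω|² ≤ M²`, the summed inequality
`Tree.leafSum_payoff_le_of_supersplit` (induction down a valid tree) and
`ratioBound_of_treeSupersolution : (S2) → (S1) → (S3) → RatioBound θ`. Part B, real states: the
dictionary `G ↦ (x, Y) = (ω_G/M, S_G/M)` (`Grad.omegaR`, `Grad.symR`), the admissible directions
`dirW c n = n × c`, `dirK c n = sym(c ⊗ n)` with `c·n = 0` (a tree split `G ↦ G + t·c⊗n` moves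
`(x, Y)` along them: `omegaR_layer`, `symR_layer`), the payoff `payoff θ x Y = xᵀYx − (θ/2)|x|²`
(`payoff_omegaR_symR`), and `ratioBound_of_supersolution` / `laminateSupConst_le_of_supersolution`
for ONE function `U : ℝ³ → 𝕄₃(ℝ) → ℝ` with `U 0 0 ≤ 0`, `φ_θ ≤ U` on the closed unit ball ×
{symmetric trace-free} and the two-point super-split inequality along admissible directions. No
`Prop` constant: every hypothesis is a binder. Everything in this file is PROVED.

WORDS AT LANDING (LEAD (κκκκ)(iii)): records — conditional reduction: laminateSupConst ≤ theta1 GIVEN the two engine legs in the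
engines' own charts; (C-b) cell-union arithmetic and (C-c) per-box engine soundness are NOT in the kernel; ‹C_lam ≤ 0.78› NOT
claimed (L4/L5 by format, referee, LEAD-human gate); numbers of record unchanged.  Every `def … : Prop` named `R18_…` / `Row…` /
`…Rows…` below is a HYPOTHESIS = an engine-certified (or pen) claim, NOT proved in this file unless a `…_holds` theorem says so.
-/

noncomputable section

open Matrix

namespace Summit.NavierStokesRegularity.FunctionalMining

namespace Laminate

/-! ## Part A — the supersolution principle at tree level (homogeneous form, rational states) -/

namespace Tree

/-- **Summing a tree supersolution down a valid tree**: below a trace-free node `G` with weight `W ≥ 0` whose subtree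
has leaf vorticity sup `≤ V = M²`, `Σ_L W_L (ω_LᵀS_Lω_L − (θ/2)M|ω_L|²) ≤ W · f M G` ((S1) at the leaves, (S3) at the
nodes; every node state lies in the ball by `vortSq_le_vortSupFrom`). [ours; elementary] -/
theorem leafSum_payoff_le_of_supersplit {θ : ℝ} {f : ℝ → Grad → ℝ} {M : ℝ}
    (hleaf : (∀ G : Grad, G.trace = 0 → (G.vortSq : ℝ) ≤ M ^ 2 → (G.stretch : ℝ) - θ / 2 * M * (G.vortSq : ℝ) ≤ f M G))
    (hsplit : (∀ (G : Grad) (s : Split), G.trace = 0 → 0 < s.lam → s.lam < 1 → s.dot = 0 →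
      (G.vortSq : ℝ) ≤ M ^ 2 → ((G.layer (1 - s.lam) s).vortSq : ℝ) ≤ M ^ 2 → ((G.layer (-s.lam) s).vortSq : ℝ) ≤ M ^ 2 →
      (s.lam : ℝ) * f M (G.layer (1 - s.lam) s) + (1 - (s.lam : ℝ)) * f M (G.layer (-s.lam) s) ≤ f M G))
    {V : ℚ} (hV : ((V : ℚ) : ℝ) = M ^ 2) (T : Tree) (hT : T.valid = true) :
    ∀ (G : Grad) (W : ℚ), G.trace = 0 → 0 ≤ W → T.vortSupFrom G ≤ V →
      (T.leafSum Grad.stretch G W : ℝ) - θ / 2 * M * (T.leafSum Grad.vortSq G W : ℝ) ≤ (W : ℝ) * f M G := by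
  induction T with
  | leaf =>
      intro G W htr hW hsup
      have hv : (G.vortSq : ℝ) ≤ M ^ 2 := by
        rw [← hV]; exact_mod_cast (show G.vortSq ≤ V by simpa [vortSupFrom] using hsup)
      have hW' : (0 : ℝ) ≤ (W : ℝ) := by exact_mod_cast hW
      have hl := mul_le_mul_of_nonneg_left (hleaf G htr hv) hW'
      simp only [leafSum]
      push_cast
      nlinarith [hl]
  | node s p m ihp ihm =>
      intro G W htr hW hsup
      obtain ⟨h0, h1, hdot, hp, hm⟩ := valid_node hT
      have htrP : (G.layer (1 - s.lam) s).trace = 0 := by rw [Grad.trace_layer, htr, hdot]; ring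
      have htrM : (G.layer (-s.lam) s).trace = 0 := by rw [Grad.trace_layer, htr, hdot]; ring
      have hc := vortSupFrom_children s p m G
      have hsupP := hc.1.trans hsup
      have hsupM := hc.2.trans hsup
      have cast : ∀ {q : ℚ}, q ≤ V → ((q : ℚ) : ℝ) ≤ M ^ 2 := fun hq => by rw [← hV]; exact_mod_cast hq
      have hvG : (G.vortSq : ℝ) ≤ M ^ 2 := cast ((vortSq_le_vortSupFrom (node s p m) hT G).trans hsup)
      have hvp : ((G.layer (1 - s.lam) s).vortSq : ℝ) ≤ M ^ 2 :=
        cast ((vortSq_le_vortSupFrom p hp _).trans hsupP)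
      have hvm : ((G.layer (-s.lam) s).vortSq : ℝ) ≤ M ^ 2 :=
        cast ((vortSq_le_vortSupFrom m hm _).trans hsupM)
      have hP := ihp hp (G.layer (1 - s.lam) s) (W * s.lam) htrP (mul_nonneg hW h0.le) hsupP
      have hM' := ihm hm (G.layer (-s.lam) s) (W * (1 - s.lam)) htrM (mul_nonneg hW (by linarith)) hsupM
      have hnode := hsplit G s htr h0 h1 hdot hvG hvp hvm
      have hWR : (0 : ℝ) ≤ (W : ℝ) := by exact_mod_cast hW
      simp only [leafSum]
      push_cast at hP hM' ⊢
      nlinarith [mul_le_mul_of_nonneg_left hnode hWR]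

end Tree

/-- **THE SUPERSOLUTION LEMMA, tree level** (homogeneous form over the tree's rational states): a family of node
functionals `f M : Grad → ℝ` (`M > 0` the vorticity ceiling) with (S2) `f M 0 ≤ 0`, (S1) LEAF MAJORISATION
`ωᵀSω − (θ/2)·M·|ω|² ≤ f M G` on trace-free states of the ball `|ω|² ≤ M²`, (S3) SUPER-SPLIT
`λ f M (G₊) + (1−λ) f M (G₋) ≤ f M G` at div-free splits with node and children in the ball, gives `RatioBound θ`, i.e. `σ(𝒯) ≤ θ·M(𝒯)·E(𝒯)` for every valid div-free lamination tree.  Proof: with `M = M(𝒯) > 0`, the summed inequality at the root reads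
`σ − (θ/2)·M·Σ_L W_L|ω_L|² ≤ f M 0 ≤ 0` and `Σ_L W_L|ω_L|² = 2E` (isometry (I1)); a tree with `M(𝒯) = 0` has `σ ≤ 0` by
the Hölder ceiling.  Search for candidate a priori estimates; no regularity claim. [ours; elementary] -/
theorem ratioBound_of_treeSupersolution {θ : ℝ} (f : ℝ → Grad → ℝ) (hroot : ∀ M : ℝ, 0 < M → f M Grad.zero ≤ 0)
    (hleaf : ∀ M : ℝ, 0 < M →
      (∀ G : Grad, G.trace = 0 → (G.vortSq : ℝ) ≤ M ^ 2 → (G.stretch : ℝ) - θ / 2 * M * (G.vortSq : ℝ) ≤ f M G))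
    (hsplit : ∀ M : ℝ, 0 < M →
      (∀ (G : Grad) (s : Split), G.trace = 0 → 0 < s.lam → s.lam < 1 → s.dot = 0 →
        (G.vortSq : ℝ) ≤ M ^ 2 → ((G.layer (1 - s.lam) s).vortSq : ℝ) ≤ M ^ 2 → ((G.layer (-s.lam) s).vortSq : ℝ) ≤ M ^ 2 →
        (s.lam : ℝ) * f M (G.layer (1 - s.lam) s) + (1 - (s.lam : ℝ)) * f M (G.layer (-s.lam) s) ≤ f M G))
    : RatioBound θ := by
  intro T hT
  have hV0 : 0 ≤ T.vortSup := Tree.vortSup_nonneg T hT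
  by_cases hz : T.vortSup = 0
  · have hsup : (T.vortSup : ℝ) ≤ (0 : ℝ) ^ 2 := by rw [hz]; simp
    have hh := Tree.abs_sigma_le_holder T hT le_rfl hsup
    have hs : (T.sigma : ℝ) ≤ 0 := by
      have := (abs_le.mp hh).2; simpa using this
    have : Real.sqrt (T.vortSup : ℝ) = 0 := by rw [hz]; simp
    rw [this]; linarith
  · have hVpos : 0 < T.vortSup := lt_of_le_of_ne hV0 (Ne.symm hz)
    set M : ℝ := Real.sqrt (T.vortSup : ℝ) with hMdef
    have hM : 0 < M := Real.sqrt_pos.mpr (by exact_mod_cast hVpos)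
    have hV : ((T.vortSup : ℚ) : ℝ) = M ^ 2 := by
      rw [hMdef, Real.sq_sqrt (by exact_mod_cast hV0)]
    have hsum := Tree.leafSum_payoff_le_of_supersplit (hleaf M hM) (hsplit M hM) hV T hT Grad.zero 1
      Grad.trace_zero zero_le_one (show T.vortSupFrom Grad.zero ≤ T.vortSup from le_rfl)
    have e6 : (T.sigma : ℝ) = (T.leafSum Grad.stretch Grad.zero 1 : ℝ) := by
      have : T.sigma = T.leafSum Grad.stretch Grad.zero 1 := by
        simp only [Tree.sigma, Tree.stretchFrom_eq_leafSum]
      exact_mod_cast this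
    have e7 : (T.leafSum Grad.vortSq Grad.zero 1 : ℝ) = 2 * (T.energy : ℝ) := by
      have : T.leafSum Grad.vortSq Grad.zero 1 = 2 * T.energy := by
        rw [Tree.energy_eq_half_leafSum_vortSq T hT]; ring
      exact_mod_cast this
    have hroot' := hroot M hM
    push_cast at hsum
    rw [← e6, e7] at hsum
    nlinarith [hsum, hroot']

/-! ## Part B — real states: one function `U(x, Y)` on `ℝ³ × 𝕄₃(ℝ)` -/

/-- Real states: a vorticity vector `x ∈ ℝ³`. [ours; bookkeeping] -/
abbrev Vec3 : Type := Fin 3 → ℝ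

/-- Real states: a strain matrix `Y ∈ 𝕄₃(ℝ)` (symmetric trace-free where it matters). [ours; bookkeeping] -/
abbrev Mat3 : Type := Matrix (Fin 3) (Fin 3) ℝ

namespace Grad

/-- `x(G) = ω_G / M ∈ ℝ³`. [ours; bookkeeping] -/
def omegaR (M : ℝ) (G : Grad) : Vec3 := ![(G.vort0 : ℝ) / M, (G.vort1 : ℝ) / M, (G.vort2 : ℝ) / M]

/-- `Y(G) = S_G / M`, `S_G = (G + Gᵀ)/2`. [ours; bookkeeping] -/
def symR (M : ℝ) (G : Grad) : Mat3 :=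
  !![(G.g00 : ℝ) / M, ((G.g01 : ℝ) + G.g10) / (2 * M), ((G.g02 : ℝ) + G.g20) / (2 * M);
     ((G.g01 : ℝ) + G.g10) / (2 * M), (G.g11 : ℝ) / M, ((G.g12 : ℝ) + G.g21) / (2 * M);
     ((G.g02 : ℝ) + G.g20) / (2 * M), ((G.g12 : ℝ) + G.g21) / (2 * M), (G.g22 : ℝ) / M]

end Grad

/-- Vorticity part of the admissible direction generated by `(c, n)`: `w = n × c` (components as the tree's
`Split.w0, w1, w2`). [ours; bookkeeping] -/
def dirW (c n : Vec3) : Vec3 :=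
  ![n 1 * c 2 - n 2 * c 1, n 2 * c 0 - n 0 * c 2, n 0 * c 1 - n 1 * c 0]

/-- Strain part of the admissible direction generated by `(c, n)`: `K = sym(c ⊗ n) = (c nᵀ + n cᵀ)/2`. [ours; bookkeeping] -/
def dirK (c n : Vec3) : Mat3 :=
  !![c 0 * n 0, (c 0 * n 1 + c 1 * n 0) / 2, (c 0 * n 2 + c 2 * n 0) / 2;
     (c 0 * n 1 + c 1 * n 0) / 2, c 1 * n 1, (c 1 * n 2 + c 2 * n 1) / 2;
     (c 0 * n 2 + c 2 * n 0) / 2, (c 1 * n 2 + c 2 * n 1) / 2, c 2 * n 2]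

namespace Split

/-- The amplitude vector `c` of a split, as a real vector. [ours; bookkeeping] -/
def cR (s : Split) : Vec3 := ![(s.c0 : ℝ), (s.c1 : ℝ), (s.c2 : ℝ)]

/-- The layering normal scaled by the ceiling, `n / M`. [ours; bookkeeping] -/
def nR (M : ℝ) (s : Split) : Vec3 := ![(s.n0 : ℝ) / M, (s.n1 : ℝ) / M, (s.n2 : ℝ) / M]

end Split

/-- The payoff `φ_θ(x, Y) = xᵀYx − (θ/2)|x|²` (K1Q1 §16.1). [ours; bookkeeping] -/
def payoff (θ : ℝ) (x : Vec3) (Y : Mat3) : ℝ := x ⬝ᵥ (Y *ᵥ x) - θ / 2 * (x ⬝ᵥ x)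

section dictionary

variable (M : ℝ)

/-- `x` is affine along layers: `x(G + t·c⊗n) = x(G) + t·(n/M × c)`. [ours; elementary] -/
theorem omegaR_layer (G : Grad) (t : ℚ) (s : Split) :
    (G.layer t s).omegaR M = G.omegaR M + (t : ℝ) • dirW s.cR (s.nR M) := by
  ext i
  fin_cases i <;>
    simp [Grad.omegaR, dirW, Split.cR, Split.nR, Grad.layer, Grad.vort0, Grad.vort1, Grad.vort2] <;> ring

/-- `Y` is affine along layers: `Y(G + t·c⊗n) = Y(G) + t·sym(c ⊗ n/M)`. [ours; elementary] -/
theorem symR_layer (G : Grad) (t : ℚ) (s : Split) :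
    (G.layer t s).symR M = G.symR M + (t : ℝ) • dirK s.cR (s.nR M) := by
  ext i j
  fin_cases i <;> fin_cases j <;>
    simp [Grad.symR, dirK, Split.cR, Split.nR, Grad.layer] <;> ring

/-- `(c) · (n/M) = (c·n)/M`. [ours; elementary] -/
theorem cR_dot_nR (s : Split) : s.cR ⬝ᵥ s.nR M = (s.dot : ℝ) / M := by
  simp [Split.cR, Split.nR, Split.dot, dotProduct, Fin.sum_univ_three]; ring

/-- `x(0) = 0`. [ours; bookkeeping] -/
theorem omegaR_zero : Grad.zero.omegaR M = 0 := by
  ext i; fin_cases i <;> simp [Grad.omegaR, Grad.zero, Grad.vort0, Grad.vort1, Grad.vort2]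

/-- `Y(0) = 0`. [ours; bookkeeping] -/
theorem symR_zero : Grad.zero.symR M = 0 := by
  ext i j; fin_cases i <;> fin_cases j <;> simp [Grad.symR, Grad.zero]

/-- `Y(G)` is symmetric. [ours; bookkeeping] -/
theorem symR_isSymm (G : Grad) : (G.symR M).IsSymm := by
  refine Matrix.IsSymm.ext ?_
  intro i j
  fin_cases i <;> fin_cases j <;> simp [Grad.symR]

/-- `tr Y(G) = tr G / M`. [ours; bookkeeping] -/
theorem symR_trace (G : Grad) : (G.symR M).trace = (G.trace : ℝ) / M := by
  simp [Grad.symR, Matrix.trace, Fin.sum_univ_three, Grad.trace]; ring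

/-- `|x(G)|² = |ω_G|²/M²`. [ours; elementary] -/
theorem omegaR_dot_self (G : Grad) : G.omegaR M ⬝ᵥ G.omegaR M = (G.vortSq : ℝ) / M ^ 2 := by
  simp [Grad.omegaR, Grad.vortSq, dotProduct, Fin.sum_univ_three]; ring

/-- `x(G)ᵀ Y(G) x(G) = ω_Gᵀ S_G ω_G / M³`. [ours; elementary] -/
theorem omegaR_symR_omegaR (G : Grad) :
    G.omegaR M ⬝ᵥ (G.symR M *ᵥ G.omegaR M) = (G.stretch : ℝ) / M ^ 3 := by
  simp [Grad.omegaR, Grad.symR, Grad.stretch, Grad.vort0, Grad.vort1, Grad.vort2, dotProduct, Matrix.mulVec,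
    Fin.sum_univ_three]
  ring

variable {M}

/-- In the ball: `|x(G)|² ≤ 1 ↔ |ω_G|² ≤ M²` (`M > 0`). [ours; elementary] -/
theorem omegaR_dot_self_le_one (hM : 0 < M) {G : Grad} (hG : (G.vortSq : ℝ) ≤ M ^ 2) :
    G.omegaR M ⬝ᵥ G.omegaR M ≤ 1 := by
  rw [omegaR_dot_self, div_le_one (by positivity)]; exact hG

/-- The homogeneous payoff is `M³·φ_θ(x(G), Y(G))`. [ours; elementary] -/
theorem payoff_omegaR_symR (hM : 0 < M) (θ : ℝ) (G : Grad) :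
    M ^ 3 * payoff θ (G.omegaR M) (G.symR M) = (G.stretch : ℝ) - θ / 2 * M * (G.vortSq : ℝ) := by
  rw [payoff, omegaR_symR_omegaR, omegaR_dot_self]
  field_simp

end dictionary

/-- **A real supersolution induces a tree supersolution** with `f M G := M³·U(ω_G/M, S_G/M)`: (S1) transfers. [ours; elementary] -/
theorem treeLeaf_of_leaf {θ : ℝ} {U : Vec3 → Mat3 → ℝ}
    (hleaf : (∀ (x : Vec3) (Y : Mat3), Y.IsSymm → Y.trace = 0 → x ⬝ᵥ x ≤ 1 → payoff θ x Y ≤ U x Y)) {M : ℝ} (hM : 0 < M)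
    (G : Grad) (htr : G.trace = 0) (hG : (G.vortSq : ℝ) ≤ M ^ 2) :
    (G.stretch : ℝ) - θ / 2 * M * (G.vortSq : ℝ) ≤ M ^ 3 * U (G.omegaR M) (G.symR M) := by
  have htr' : (G.symR M).trace = 0 := by rw [symR_trace, htr]; simp
  have hl := hleaf (G.omegaR M) (G.symR M) (symR_isSymm M G) htr' (omegaR_dot_self_le_one hM hG)
  have := mul_le_mul_of_nonneg_left hl (pow_nonneg hM.le 3)
  rwa [payoff_omegaR_symR hM] at this

/-- **A real supersolution induces a tree supersolution**: (S3) transfers (the split direction of the tree, `c ⊗ n` with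
rational `c, n`, is the admissible real direction generated by `(c, n/M)`). [ours; elementary] -/
theorem treeSplit_of_split {U : Vec3 → Mat3 → ℝ}
    (hsplit : (∀ (x : Vec3) (Y : Mat3) (c n : Vec3) (l : ℝ), Y.IsSymm → Y.trace = 0 → c ⬝ᵥ n = 0 →
      0 < l → l < 1 → x ⬝ᵥ x ≤ 1 → (x + (1 - l) • dirW c n) ⬝ᵥ (x + (1 - l) • dirW c n) ≤ 1 →
      (x + (-l) • dirW c n) ⬝ᵥ (x + (-l) • dirW c n) ≤ 1 →
      l * U (x + (1 - l) • dirW c n) (Y + (1 - l) • dirK c n)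
        + (1 - l) * U (x + (-l) • dirW c n) (Y + (-l) • dirK c n) ≤ U x Y)) {M : ℝ} (hM : 0 < M)
    (G : Grad) (s : Split) (htr : G.trace = 0) (h0 : 0 < s.lam) (h1 : s.lam < 1) (hdot : s.dot = 0)
    (hG : (G.vortSq : ℝ) ≤ M ^ 2) (hGp : ((G.layer (1 - s.lam) s).vortSq : ℝ) ≤ M ^ 2)
    (hGm : ((G.layer (-s.lam) s).vortSq : ℝ) ≤ M ^ 2) :
    (s.lam : ℝ) * (M ^ 3 * U ((G.layer (1 - s.lam) s).omegaR M) ((G.layer (1 - s.lam) s).symR M))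
      + (1 - (s.lam : ℝ)) * (M ^ 3 * U ((G.layer (-s.lam) s).omegaR M) ((G.layer (-s.lam) s).symR M))
      ≤ M ^ 3 * U (G.omegaR M) (G.symR M) := by
  have htr' : (G.symR M).trace = 0 := by rw [symR_trace, htr]; simp
  have hcn : s.cR ⬝ᵥ s.nR M = 0 := by rw [cR_dot_nR, hdot]; simp
  have hl0 : (0 : ℝ) < s.lam := by exact_mod_cast h0
  have hl1 : (s.lam : ℝ) < 1 := by exact_mod_cast h1
  have hx := omegaR_dot_self_le_one hM hG
  have hxp := omegaR_dot_self_le_one hM hGp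
  have hxm := omegaR_dot_self_le_one hM hGm
  rw [omegaR_layer] at hxp hxm
  have e1 : (((1 - s.lam : ℚ)) : ℝ) = 1 - (s.lam : ℝ) := by push_cast; ring
  have e2 : (((-s.lam : ℚ)) : ℝ) = -(s.lam : ℝ) := by push_cast; ring
  rw [e1] at hxp
  rw [e2] at hxm
  have hs := hsplit (G.omegaR M) (G.symR M) s.cR (s.nR M) (s.lam : ℝ) (symR_isSymm M G) htr' hcn hl0 hl1 hx hxp hxm
  rw [omegaR_layer, omegaR_layer, symR_layer, symR_layer, e1, e2]
  have hM3 : (0 : ℝ) ≤ M ^ 3 := pow_nonneg hM.le 3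
  nlinarith [mul_le_mul_of_nonneg_left hs hM3]

/-- **THE SUPERSOLUTION LEMMA (K1Q1 §16.1), kernel form**: a function `U : ℝ³ → 𝕄₃(ℝ) → ℝ` with (S2) `U(0,0) ≤ 0`, (S1)
`φ_θ ≤ U` on `{|x| ≤ 1} × {Y symmetric trace-free}` and (S3) the super-split inequality
`λ·U(x + (1−λ)w, Y + (1−λ)K) + (1−λ)·U(x − λw, Y − λK) ≤ U(x, Y)` along admissible directions `(w, K) = (n × c, sym(c⊗n))`,
`c·n = 0`, `0 < λ < 1`, at points of the closed unit ball, bounds the laminate ratio of EVERY valid div-free lamination tree: `RatioBound θ`; hence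
`laminateSupConst ≤ θ`.  Search for candidate a priori estimates; no regularity claim. [ours; elementary] -/
theorem ratioBound_of_supersolution {θ : ℝ} (U : Vec3 → Mat3 → ℝ) (hroot : U 0 0 ≤ 0)
    (hleaf : (∀ (x : Vec3) (Y : Mat3), Y.IsSymm → Y.trace = 0 → x ⬝ᵥ x ≤ 1 → payoff θ x Y ≤ U x Y))
    (hsplit : (∀ (x : Vec3) (Y : Mat3) (c n : Vec3) (l : ℝ), Y.IsSymm → Y.trace = 0 → c ⬝ᵥ n = 0 →
      0 < l → l < 1 → x ⬝ᵥ x ≤ 1 → (x + (1 - l) • dirW c n) ⬝ᵥ (x + (1 - l) • dirW c n) ≤ 1 →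
      (x + (-l) • dirW c n) ⬝ᵥ (x + (-l) • dirW c n) ≤ 1 →
      l * U (x + (1 - l) • dirW c n) (Y + (1 - l) • dirK c n)
        + (1 - l) * U (x + (-l) • dirW c n) (Y + (-l) • dirK c n) ≤ U x Y))
    : RatioBound θ := by
  refine ratioBound_of_treeSupersolution (fun M G => M ^ 3 * U (G.omegaR M) (G.symR M)) ?_
    (fun M hM => treeLeaf_of_leaf hleaf hM) (fun M hM => treeSplit_of_split hsplit hM)
  intro M hM
  show M ^ 3 * U (Grad.zero.omegaR M) (Grad.zero.symR M) ≤ 0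
  rw [omegaR_zero, symR_zero]
  exact mul_nonpos_of_nonneg_of_nonpos (pow_nonneg hM.le 3) hroot

/-- `… → laminateSupConst ≤ θ`. [ours; elementary] -/
theorem laminateSupConst_le_of_supersolution {θ : ℝ} (U : Vec3 → Mat3 → ℝ) (hroot : U 0 0 ≤ 0)
    (hleaf : (∀ (x : Vec3) (Y : Mat3), Y.IsSymm → Y.trace = 0 → x ⬝ᵥ x ≤ 1 → payoff θ x Y ≤ U x Y))
    (hsplit : (∀ (x : Vec3) (Y : Mat3) (c n : Vec3) (l : ℝ), Y.IsSymm → Y.trace = 0 → c ⬝ᵥ n = 0 →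
      0 < l → l < 1 → x ⬝ᵥ x ≤ 1 → (x + (1 - l) • dirW c n) ⬝ᵥ (x + (1 - l) • dirW c n) ≤ 1 →
      (x + (-l) • dirW c n) ⬝ᵥ (x + (-l) • dirW c n) ≤ 1 →
      l * U (x + (1 - l) • dirW c n) (Y + (1 - l) • dirK c n)
        + (1 - l) * U (x + (-l) • dirW c n) (Y + (-l) • dirK c n) ≤ U x Y))
    : laminateSupConst ≤ θ :=
  laminateSupConst_le_of_ratioBound (ratioBound_of_supersolution U hroot hleaf hsplit)


end Laminate

end Summit.NavierStokesRegularity.FunctionalMining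

end
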